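import Summits.ABC.StewartYu.ArchG3HalfDescent
import HarnessLib

/-!
# Cell abc-stewartyu, rung A1.L (crux r2 `ArchCoreRat`), WP-L.A: the VIRTUAL INTERVAL BOX as the family invariant `Q` and the pointwise
# predicate `V` of the generic schedule (R32 (c1) / R34-implementation) — the canonical instance for a ℤ-linear coordinate map `ν`

`Summits/ABC/StewartYu/ArchG3VirtualBox.lean` — cell `abc-stewartyu` (HOME `run/shared/lean/pub/abc-stewartyu/`; seat lp-1 g8).  Two definitions
and theorems on `ArchG3Setup`; no named fact, no numerics.  For an additive map `ν : ℤⁿ → ℤⁿ` (at `S(θ)`: the θ-coordinates ↦ the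
`N`-scaled α-coordinates `μ ↦ μ ᵥ* U` of the saturated data, seat p5 `ArchG3SatData`) and per-level virtual sides `Lν lev`:

* `VBoxQ ν Lν B v lev` — the family invariant: ONE interval box `[loν, loν + Lν lev] ∋ 0` containing all `ν(vᵢ)`, `i ∈ B`
  (the `Q` of `ArchG3ScheduleQ/D`); `VBoxV ν Lν lev w′ := ∀ j, |ν(w′)ⱼ| ≤ Lν lev j` — the pointwise predicate (the `V` of the packages);
* `vboxV_of_vboxQ` — the link `hQV` (an interval of length `L` containing `0` lies in `[−L, L]`);
* `map_halfDiff` — `ν(halfDiff v i₀ i) = halfDiff (ν ∘ v) i₀ i` on the parity class (ν is additive);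
* `vboxQ_halfStep` — the propagation `hQhalf`: `VBoxQ ν Lν B v lev → VBoxQ ν Lν (parityClass v B i₀) (halfDiff v i₀) (lev+1)` for `i₀ ∈ B`
  when `Lν (lev+1) = Lν lev / 2` — the virtual box HALVES at every level exactly like the θ-box (`halfDiff_box` applied to `ν ∘ v`);
* `vboxQ_mono` — restriction to a sub-family.

WHAT THIS IS NOT: no choice of `ν`/`Lν` (record); no crux moves.

References: Yu. V. Nesterenko, LNM 1819 (2003) §4.3 (4.46)–(4.50) p. 93–94 (the descent of the box), §3.4 p. 104–107 (exponents in 𝔑)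
[Nesterenko2003]; K. Yu, Acta Math. 211 (2013) §5.1 (the last-level virtual box `Dⱼ`) [Yu2013].
-/

noncomputable section

open Finset

namespace Summit.ABC.StewartYu

namespace ArchG3Setup

variable (S : ArchG3Setup)

/-- **The virtual interval box of a family** (the `Q` of the generic schedule): one interval `[loν ⱼ, loν ⱼ + Lν lev j] ∋ 0` per coordinate
containing every `ν(vᵢ)ⱼ`, `i ∈ B`. [cite: Nesterenko2003, §3.4 (the set 𝔑 ∩ 𝔚 in coordinates), p. 104–106; shape only] -/
def VBoxQ (ν : (Fin S.n → ℤ) →+ (Fin S.n → ℤ)) (Lν : ℕ → Fin S.n → ℕ) (B : Finset (ℕ × (Fin S.n → ℤ)))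
    (v : (ℕ × (Fin S.n → ℤ)) → Fin S.n → ℤ) (lev : ℕ) : Prop :=
  ∃ loν : Fin S.n → ℤ, (∀ j, loν j ≤ 0 ∧ 0 ≤ loν j + (Lν lev j : ℤ)) ∧
    ∀ i ∈ B, ∀ j, loν j ≤ ν (v i) j ∧ ν (v i) j ≤ loν j + (Lν lev j : ℤ)

/-- **The pointwise virtual box** (the `V` of the generic packages): `|ν(w′)ⱼ| ≤ Lν lev j`. [cite: Nesterenko2003, §3.4, p. 104–106; shape only] -/
def VBoxV (ν : (Fin S.n → ℤ) →+ (Fin S.n → ℤ)) (Lν : ℕ → Fin S.n → ℕ) (lev : ℕ) (w' : Fin S.n → ℤ) : Prop :=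
  ∀ j, |ν w' j| ≤ (Lν lev j : ℤ)

variable {S}

/-- **The link `hQV`**: the family box gives the pointwise box for every member. [folklore] -/
theorem vboxV_of_vboxQ {ν : (Fin S.n → ℤ) →+ (Fin S.n → ℤ)} {Lν : ℕ → Fin S.n → ℕ} (lev : ℕ) (B : Finset (ℕ × (Fin S.n → ℤ)))
    (v : (ℕ × (Fin S.n → ℤ)) → Fin S.n → ℤ) (h : S.VBoxQ ν Lν B v lev) : ∀ i ∈ B, S.VBoxV ν Lν lev (v i) := by
  obtain ⟨loν, hlo, hbox⟩ := h
  intro i hi j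
  have h1 := hlo j
  have h2 := hbox i hi j
  rw [abs_le]
  constructor <;> omega

/-- Restriction of the family box to a sub-family. [folklore] -/
theorem vboxQ_mono {ν : (Fin S.n → ℤ) →+ (Fin S.n → ℤ)} {Lν : ℕ → Fin S.n → ℕ} {lev : ℕ} {B B' : Finset (ℕ × (Fin S.n → ℤ))}
    {v : (ℕ × (Fin S.n → ℤ)) → Fin S.n → ℤ} (hB' : B' ⊆ B) (h : S.VBoxQ ν Lν B v lev) : S.VBoxQ ν Lν B' v lev := by
  obtain ⟨loν, hlo, hbox⟩ := h
  exact ⟨loν, hlo, fun i hi => hbox i (hB' hi)⟩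

/-- **ν commutes with the half-difference** on the parity class: `ν(halfDiff v i₀ i) = halfDiff (ν ∘ v) i₀ i` (ν additive, `vᵢ = v_{i₀} +
2·halfDiff`). [folklore] -/
theorem map_halfDiff (ν : (Fin S.n → ℤ) →+ (Fin S.n → ℤ)) {ι : Type*} (v : ι → Fin S.n → ℤ) {i₀ i : ι}
    (hpar : ∀ j, 2 ∣ v i j - v i₀ j) : ν (S.halfDiff v i₀ i) = S.halfDiff (fun i => ν (v i)) i₀ i := by
  have h1 : v i = v i₀ + (2 : ℤ) • S.halfDiff v i₀ i := S.eq_add_two_smul_halfDiff v hpar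
  have h2 : ν (v i) = ν (v i₀) + (2 : ℤ) • ν (S.halfDiff v i₀ i) := by
    conv_lhs => rw [h1]
    rw [map_add, map_zsmul]
  funext j
  have h3 := congrFun h2 j
  simp only [Pi.add_apply, Pi.smul_apply, smul_eq_mul] at h3
  simp only [halfDiff, h3]
  omega

/-- Parities are preserved by ν: `2 ∣ ν(vᵢ)ⱼ − ν(v_{i₀})ⱼ` on the parity class. [folklore] -/
theorem two_dvd_map_sub (ν : (Fin S.n → ℤ) →+ (Fin S.n → ℤ)) {ι : Type*} (v : ι → Fin S.n → ℤ) {i₀ i : ι}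
    (hpar : ∀ j, 2 ∣ v i j - v i₀ j) : ∀ j, 2 ∣ ν (v i) j - ν (v i₀) j := by
  have h1 : v i = v i₀ + (2 : ℤ) • S.halfDiff v i₀ i := S.eq_add_two_smul_halfDiff v hpar
  have h2 : ν (v i) = ν (v i₀) + (2 : ℤ) • ν (S.halfDiff v i₀ i) := by
    conv_lhs => rw [h1]
    rw [map_add, map_zsmul]
  intro j
  have h3 := congrFun h2 j
  simp only [Pi.add_apply, Pi.smul_apply, smul_eq_mul] at h3
  exact ⟨ν (S.halfDiff v i₀ i) j, by rw [h3]; ring⟩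

/-- **The propagation `hQhalf`: the virtual box halves across the half-step.**  For `i₀ ∈ B` and `Lν (lev+1) = Lν lev / 2`:
`VBoxQ ν Lν B v lev → VBoxQ ν Lν (parityClass v B i₀) (halfDiff v i₀) (lev + 1)` — `halfDiff_box` applied to the family `ν ∘ v`.
[cite: Nesterenko2003, §4.3 (4.46)–(4.50), p. 93–94] -/
theorem vboxQ_halfStep {ν : (Fin S.n → ℤ) →+ (Fin S.n → ℤ)} {Lν : ℕ → Fin S.n → ℕ} {lev : ℕ} (hL : ∀ j, Lν (lev + 1) j = Lν lev j / 2)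
    {B : Finset (ℕ × (Fin S.n → ℤ))} {v : (ℕ × (Fin S.n → ℤ)) → Fin S.n → ℤ} {i₀ : ℕ × (Fin S.n → ℤ)} (hi₀ : i₀ ∈ B)
    (h : S.VBoxQ ν Lν B v lev) : S.VBoxQ ν Lν (S.parityClass v B i₀) (S.halfDiff v i₀) (lev + 1) := by
  classical
  obtain ⟨loν, hlo, hbox⟩ := h
  refine ⟨fun j => -((ν (v i₀) j - loν j) / 2), fun j => ?_, fun i hi j => ?_⟩
  · have h1 := S.halfDiff_lo_le (fun i => ν (v i)) hlo (hbox i₀ hi₀) j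
    rw [hL j]
    exact h1
  · obtain ⟨hiB, hpar⟩ := (S.mem_parityClass v).mp hi
    have h1 := S.halfDiff_box (fun i => ν (v i)) (S.two_dvd_map_sub ν v hpar) (hbox i hiB) (hbox i₀ hi₀) j
    rw [hL j, S.map_halfDiff ν v hpar]
    exact h1

/-- **The family box at the START** (the `hQ0` of `archLevelStateQ_zeroD`): if the coordinates `ν(i.2)` of the members and of the base
point `λ♭` all lie in ONE integer interval box `[tlo, tlo + Lν lev]` (e.g. the translated box of the `𝔑`-count, `SatBoxTranslate`), then the
DIFFERENCES `i.2 − λ♭` satisfy `VBoxQ ν Lν B (fun i => i.2 − λ♭) lev` (interval `[tlo − ν(λ♭), tlo − ν(λ♭) + Lν lev] ∋ 0`).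
[cite: Nesterenko2003, §3.3–3.4 (the translated box of 𝔑-points), p. 68–71; shape only] -/
theorem vboxQ_of_interval {ν : (Fin S.n → ℤ) →+ (Fin S.n → ℤ)} {Lν : ℕ → Fin S.n → ℕ} {lev : ℕ} (tlo : Fin S.n → ℤ)
    (B : Finset (ℕ × (Fin S.n → ℤ))) (hB : ∀ i ∈ B, ∀ j, tlo j ≤ ν i.2 j ∧ ν i.2 j ≤ tlo j + (Lν lev j : ℤ))
    (lamb : Fin S.n → ℤ) (hlamb : ∀ j, tlo j ≤ ν lamb j ∧ ν lamb j ≤ tlo j + (Lν lev j : ℤ)) :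
    S.VBoxQ ν Lν B (fun i => i.2 - lamb) lev := by
  refine ⟨fun j => tlo j - ν lamb j, fun j => ?_, fun i hi j => ?_⟩
  · have h1 := hlamb j
    dsimp only
    constructor <;> omega
  · have h1 := hB i hi j
    have h2 := hlamb j
    have e1 : ν (i.2 - lamb) j = ν i.2 j - ν lamb j := by rw [map_sub]; rfl
    rw [e1]
    dsimp only
    constructor <;> omega

end ArchG3Setup

end Summit.ABC.StewartYu

end
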